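import Mathlib

/-!
# EriceRemainderEnclosureHistoryAutonomyComparisonAgeCompositionClusterCascadeYoungest — (E96a) route (N), first order: THE CLUSTER CASCADE WITH A SHARP LAST
# STEP (pure).  In (E95c) `renewal_nonneg_cluster_cascade` every gap between consecutive levels, INCLUDING the gap `lo_1 ∕ hi_0` between the youngest level and
# the next, must be at least the uniform ratio `R₀` of the closure `κ + 4s(1+κ) ≤ R₀(1 − s(1+κ))κ` (`R₀ ≈ 58`).  But the youngest level is the LAST one of
# the descent: the bound it receives on the variation of the older reads is consumed once (by its own targets) and never propagated further.  So the last
# gap needs only its own, much weaker, inequality: with `ρ₀·hi_0 ≤ lo_1`, `λ = 1 − s(1+κ)`, the targets of the youngest level are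
# `≤ (1 + (4s(1+κ) + κ)∕(ρ₀λ))·B_1` and the END holds as soon as `s₀·(1 + (4s(1+κ) + κ)∕(ρ₀λ)) ≤ 1` — for a single young age (`s₀ = 0.7072`) and single
# older ages (`s ≈ 0.616`, `κ = 1∕5`) this is `ρ₀ ≥ 30` (against `58`), and `ρ₀ ≥ 21` at `κ = 19∕200`

Cell `pub-balaban`, β-function sub-cell, BINDER row D4 «RemainderConst leaves for Bałaban's split» (`HOME/BINDER-OWNERS.md`; owner lineage `b2b-balaban-beta-an4`;
this file by co-owner #2 lineage `b2b-balaban-beta-d4-p2`, generation 85), β-FLOW TEAM duty (1), FREEZE (0) honoured (def-free; Mathlib only; nothing restated).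
Sequel of (E95c) `…ClusterCascade` (same abstract renewal language; the level lemma here carries two constants).

HONEST FRAMING (page 1, verbatim and binding).  *"Discharging BetaPertH makes Bałaban's UV stability UNCONDITIONAL — a real constructive-QFT result; it is
NOT the continuum limit and NOT the Clay problem."*  THIS FILE DISCHARGES NOTHING OF THE KIND.  Elementary real algebra about ABSTRACT real sequences and
triangular renewal systems — hypotheses of a census, not facts; the form, signs, ages and moments of Bałaban's (1.22) limit functional are NOT PRINTED
([I] p. 298; GAPS G-t4-U2-1∕-2) and NOT asserted.  Row D4 class UNCHANGED (critical-path width 0; instance 0∕1; D4 DISCHARGE NO DATE).  HONEST DEPENDENCY: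
continuum YM on T⁴ ⇐ BetaPertH ∧ nine spine estimates (0/9 proved); BetaPertH ⇐ (D1) ∧ (D4) ∧ CAP+tail; G-an2-4 gates asym, D1 and NE2/3/4.

THE POINT (README `HOME/b2b-balaban-beta-d4-p2/g85/README.md` §5).  The descent of (E95c) establishes at level `1`: `B_1 ≥ λB_2 ≥ 0`, the targets of every level
`j' ≥ 1` are `≤ (1+κ)B_{j'+1}`, and `hi_1U_1 ≤ κB_2`.  The youngest level's targets `q ∈ (m, m+hi_0]` then satisfy `ε_q ≤ B_1 + hi_0·U_0` with
`hi_0U_0 = hi_0(ν_1(1+κ)B_2 + U_1) ≤ (hi_0∕lo_1)(4x_1(1+κ) + κ)B_2 ≤ (4s(1+κ)+κ)∕(ρ₀λ)·B_1 =: κ₀B_1`, so `O^0_m ≤ x_0(1+κ₀)B_1` and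
`ε_m = B_0 ≥ (1 − s₀(1+κ₀))B_1 ≥ 0`.  Nothing requires `κ₀ ≤ κ`.  NOT CLAIMED: any mass bound (hypotheses here; flow instances in (E96b)); anything nonlinear;
anything printed — NOT B12 Thm 2, NOT BetaPertH.

WHAT IS PROVED ([folklore]; 0 `def`, 0 sorry).  §1 `cluster_cascade_level_two` (the level lemma with the variation budget `D` decoupled from the older targets'
constant `C`).  §2 **`renewal_nonneg_cluster_cascade_youngest`** (the END for `r` cluster reads with the uniform ratio `R₀` between the older levels and the
sharp last-step condition at ratio `ρ₀` for the youngest).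
-/
noncomputable section
open Finset

namespace Summit.QuantumFields.BalabanUV.Beta.EriceRemainderEnclosureHistoryAutonomyComparisonAgeCompositionClusterCascadeYoungest

/-! ## §1 One level, two constants -/

/-- **ONE LEVEL OF THE CLUSTER CASCADE WITH TWO CONSTANTS (pure, one pin `m`, one level `j`).**  As (E95c) `cluster_cascade_level`, but the accumulated
variation of the older levels is bounded by `D·B (j+1)` with `D ≥ 0` independent of the constant `C ≥ 1` bounding the older targets: reads
`O j' q = Σ_{l<Kw} w j' q l·ε_{q+1+l}` (non-negative weights vanishing for `l ≥ hi j'`, row sums `≤ x_{j'}(q)`), `ε_q = e_q − Σ_{j'<r} O j' q`, `0 ≤ ε ≤ e`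
beyond `m`, `e` non-increasing, `hi j ≤ lo j'` for `j < j' < r`, relative variation of the older levels with rates `ν ≥ 0`, residuals
`B j' = e_m − Σ_{i∈[j',r)} O i m` with `B j' ≥ 0` for `j < j' ≤ r`, older targets `≤ C·B (j'+1)`, and `hi_j·Σ_{j'∈(j,r)} ν_{j'}(m)·C·B(j'+1) ≤ D·B (j+1)`.
THEN the targets of level `j` are `≤ (1+D)·B (j+1)` and `B j ≥ (1 − x_j(m)(1+D))·B (j+1)`. [folklore] -/
theorem cluster_cascade_level_two {r Kw m j : ℕ} {C D : ℝ} {lo hi : ℕ → ℕ} {w : ℕ → ℕ → ℕ → ℝ} {x ν O : ℕ → ℕ → ℝ} {e ε B : ℕ → ℝ}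
    (hjr : j < r) (hC : 1 ≤ C) (hD : 0 ≤ D)
    (hw0 : ∀ j' q l, 0 ≤ w j' q l) (hwa : ∀ j' q l, hi j' ≤ l → w j' q l = 0) (hν0 : ∀ j' q, 0 ≤ ν j' q)
    (hrow : ∀ j' q, j' < r → ∑ l ∈ range Kw, w j' q l ≤ x j' q)
    (hO : ∀ j' q, O j' q = ∑ l ∈ range Kw, w j' q l * ε (q + 1 + l))
    (hsep : ∀ j', j < j' → j' < r → hi j ≤ lo j')
    (hvar : ∀ j' d (T : ℝ), j < j' → j' < r → 1 ≤ d → d ≤ lo j' → 0 ≤ T → (∀ q, m < q → 0 ≤ ε q) →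
      (∀ q, m < q → q ≤ m + hi j' → ε q ≤ T) → O j' m - O j' (m + d) ≤ ν j' m * d * T)
    (hea : ∀ q, e (q + 1) ≤ e q) (hrec : ∀ q, ε q = e q - ∑ i ∈ range r, O i q)
    (IH : ∀ q, m < q → 0 ≤ ε q ∧ ε q ≤ e q)
    (hB : ∀ j', B j' = e m - ∑ i ∈ Ico j' r, O i m)
    (hBnn : ∀ j', j < j' → j' ≤ r → 0 ≤ B j')
    (hT : ∀ j', j < j' → j' < r → ∀ q, m < q → q ≤ m + hi j' → ε q ≤ C * B (j' + 1))
    (hU : (hi j : ℝ) * ∑ i ∈ Ico (j + 1) r, ν i m * (C * B (i + 1)) ≤ D * B (j + 1)) :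
    (∀ q, m < q → q ≤ m + hi j → ε q ≤ (1 + D) * B (j + 1)) ∧ (1 - x j m * (1 + D)) * B (j + 1) ≤ B j := by
  have hea' : ∀ p q, p ≤ q → e q ≤ e p := by
    intro p q hpq
    induction q, hpq using Nat.le_induction with
    | base => exact le_rfl
    | succ q _ ih => exact (hea q).trans ih
  have hOnn : ∀ i q, m ≤ q → 0 ≤ O i q := fun i q hq => by
    rw [hO]; exact sum_nonneg fun l _ => mul_nonneg (hw0 i q l) (IH _ (by omega)).1
  have hBj1 : 0 ≤ B (j + 1) := hBnn (j + 1) (by omega) (by omega)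
  have htar : ∀ q, m < q → q ≤ m + hi j → ε q ≤ (1 + D) * B (j + 1) := by
    intro q hmq hqa
    obtain ⟨d, rfl⟩ : ∃ d, q = m + d := ⟨q - m, by omega⟩
    have hd1 : 1 ≤ d := by omega
    have hda : d ≤ hi j := by omega
    have h1 : ε (m + d) ≤ e m - ∑ i ∈ Ico (j + 1) r, O i (m + d) := by
      rw [hrec (m + d)]
      have hsplit := (sum_range_add_sum_Ico (fun i => O i (m + d)) (show j + 1 ≤ r by omega)).symm
      have hlow : 0 ≤ ∑ i ∈ range (j + 1), O i (m + d) := sum_nonneg fun i _ => hOnn i (m + d) (by omega)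
      have hem := hea' m (m + d) (by omega)
      rw [hsplit]; linarith
    have h2 : ∑ i ∈ Ico (j + 1) r, (O i m - O i (m + d)) ≤ ∑ i ∈ Ico (j + 1) r, ν i m * (hi j : ℝ) * (C * B (i + 1)) := by
      refine sum_le_sum fun i hi' => ?_
      have hi'' := mem_Ico.mp hi'
      have hdai : d ≤ lo i := hda.trans (hsep i (by omega) hi''.2)
      have hTnn : 0 ≤ C * B (i + 1) := mul_nonneg (by linarith) (hBnn (i + 1) (by omega) (by omega))
      have hv := hvar i d (C * B (i + 1)) (by omega) hi''.2 hd1 hdai hTnn (fun q hq => (IH q hq).1) (hT i (by omega) hi''.2)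
      have hdr : (d : ℝ) ≤ hi j := by exact_mod_cast hda
      have h3 : ν i m * (d : ℝ) * (C * B (i + 1)) ≤ ν i m * (hi j : ℝ) * (C * B (i + 1)) :=
        mul_le_mul_of_nonneg_right (mul_le_mul_of_nonneg_left hdr (hν0 i m)) hTnn
      exact hv.trans h3
    have h3 : ∑ i ∈ Ico (j + 1) r, ν i m * (hi j : ℝ) * (C * B (i + 1))
        = (hi j : ℝ) * ∑ i ∈ Ico (j + 1) r, ν i m * (C * B (i + 1)) := by
      rw [mul_sum]; exact sum_congr rfl fun i _ => by ring
    have h4 : ∑ i ∈ Ico (j + 1) r, O i (m + d) = ∑ i ∈ Ico (j + 1) r, O i m - ∑ i ∈ Ico (j + 1) r, (O i m - O i (m + d)) := by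
      rw [← sum_sub_distrib]; exact sum_congr rfl fun i _ => by ring
    have hB1 := hB (j + 1)
    rw [h3] at h2
    rw [h4] at h1
    have : (1 + D) * B (j + 1) = B (j + 1) + D * B (j + 1) := by ring
    linarith [h1, h2, hU, hB1]
  refine ⟨htar, ?_⟩
  have hOj : O j m ≤ x j m * ((1 + D) * B (j + 1)) := by
    rw [hO]
    calc ∑ l ∈ range Kw, w j m l * ε (m + 1 + l) ≤ ∑ l ∈ range Kw, w j m l * ((1 + D) * B (j + 1)) := by
          refine sum_le_sum fun l _ => ?_
          by_cases hl : l < hi j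
          · exact mul_le_mul_of_nonneg_left (htar (m + 1 + l) (by omega) (by omega)) (hw0 j m l)
          · rw [hwa j m l (not_lt.mp hl)]; simp
      _ = (∑ l ∈ range Kw, w j m l) * ((1 + D) * B (j + 1)) := by rw [sum_mul]
      _ ≤ x j m * ((1 + D) * B (j + 1)) := mul_le_mul_of_nonneg_right (hrow j m hjr) (mul_nonneg (by linarith) hBj1)
  have hBj : B j = B (j + 1) - O j m := by
    rw [hB j, hB (j + 1), sum_eq_sum_Ico_succ_bot hjr]; ring
  rw [hBj]
  nlinarith [hOj]

/-! ## §2 The cluster cascade with a sharp last step -/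

/-- **THE CLUSTER CASCADE WITH A SHARP LAST STEP (pure).**  `ε_q = e_q − Σ_{j<r} O j q` at every pin, `ε = 0` beyond the horizon `N`, `e ≥ 0`
non-increasing; level `j < r` reads `O j q = Σ_{l<Kw} w j q l·ε_{q+1+l}` with non-negative weights vanishing for `l ≥ hi j`, row sums `≤ x_j(q)` (`x ≥ 0`),
MASS CAPS `x_0 ≤ s₀`, `x_j ≤ s` (`j ≥ 1`); levels `j ≥ 1` have `lo j ≤ hi j`, a rate `ν_j ≥ 0` with `lo_j·ν_j ≤ 4x_j`, and the relative variation
`O j m − O j (m+d) ≤ ν_j(m)·d·T` (`1 ≤ d ≤ lo j`, `ε ≥ 0` beyond `m`, own targets `≤ T`, `T ≥ 0`); SEPARATION `R₀·hi j ≤ lo (j+1)` for `j ≥ 1` and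
`ρ₀·hi 0 ≤ lo 1` for the youngest gap.  CLOSURES (`C = 1+κ`, `λ = 1 − sC`): `κ > 0`, `s ≥ 0`, `sC < 1`, `κ + 4sC ≤ R₀·λ·κ` (older levels) and
`s₀·(ρ₀λ + 4sC + κ) ≤ ρ₀λ`, `ρ₀ ≥ 1` (the last step).  THEN `0 ≤ ε ≤ e` at every pin — EVERY `r`, whatever the total mass. [folklore] -/
theorem renewal_nonneg_cluster_cascade_youngest {r N Kw R₀ ρ₀ : ℕ} {κ s₀ s : ℝ} {lo hi : ℕ → ℕ} {w : ℕ → ℕ → ℕ → ℝ} {x ν O : ℕ → ℕ → ℝ}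
    {e ε : ℕ → ℝ}
    (hκ : 0 < κ) (hs : 0 ≤ s) (hsC : s * (1 + κ) < 1)
    (hR : κ + 4 * s * (1 + κ) ≤ (R₀ : ℝ) * (1 - s * (1 + κ)) * κ)
    (hρ₀ : 1 ≤ ρ₀) (hyoung : s₀ * ((ρ₀ : ℝ) * (1 - s * (1 + κ)) + (4 * s * (1 + κ) + κ)) ≤ (ρ₀ : ℝ) * (1 - s * (1 + κ)))
    (hsep0 : 1 < r → ρ₀ * hi 0 ≤ lo 1) (hsep : ∀ j, 1 ≤ j → j + 1 < r → R₀ * hi j ≤ lo (j + 1))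
    (hlohi : ∀ j, 1 ≤ j → j < r → lo j ≤ hi j)
    (hw0 : ∀ j q l, 0 ≤ w j q l) (hwa : ∀ j q l, hi j ≤ l → w j q l = 0) (hx0 : ∀ j q, 0 ≤ x j q) (hν0 : ∀ j q, 0 ≤ ν j q)
    (hrow : ∀ j q, j < r → ∑ l ∈ range Kw, w j q l ≤ x j q)
    (hcap0 : ∀ q, x 0 q ≤ s₀) (hcap : ∀ j q, 1 ≤ j → j < r → x j q ≤ s) (hνx : ∀ j q, 1 ≤ j → j < r → (lo j : ℝ) * ν j q ≤ 4 * x j q)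
    (hO : ∀ j q, O j q = ∑ l ∈ range Kw, w j q l * ε (q + 1 + l))
    (hvar : ∀ j m d (T : ℝ), 1 ≤ j → j < r → 1 ≤ d → d ≤ lo j → 0 ≤ T → (∀ q, m < q → 0 ≤ ε q) →
      (∀ q, m < q → q ≤ m + hi j → ε q ≤ T) → O j m - O j (m + d) ≤ ν j m * d * T)
    (he0 : ∀ q, 0 ≤ e q) (hea : ∀ q, e (q + 1) ≤ e q)
    (hεt : ∀ q, N < q → ε q = 0) (hrec : ∀ q, ε q = e q - ∑ j ∈ range r, O j q) : ∀ m, 0 ≤ ε m ∧ ε m ≤ e m := by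
  suffices step : ∀ m, (∀ q, m < q → 0 ≤ ε q ∧ ε q ≤ e q) → 0 ≤ ε m ∧ ε m ≤ e m by
    have main : ∀ n m, N < m + n → 0 ≤ ε m ∧ ε m ≤ e m := by
      intro n
      induction n with
      | zero => intro m hm; rw [hεt m (by omega)]; exact ⟨le_rfl, he0 m⟩
      | succ n ih => intro m hm; exact step m fun q hq => ih q (by omega)
    exact fun m => main (N + 1) m (by omega)
  intro m IH
  have hOnn : ∀ i q, m ≤ q → 0 ≤ O i q := fun i q hq => by
    rw [hO]; exact sum_nonneg fun l _ => mul_nonneg (hw0 i q l) (IH _ (by omega)).1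
  have hsum0 : 0 ≤ ∑ j ∈ range r, O j m := sum_nonneg fun j _ => hOnn j m le_rfl
  refine ⟨?_, by rw [hrec m]; linarith⟩
  -- constants
  set C : ℝ := 1 + κ with hC_def
  have hC1 : 1 ≤ C := by rw [hC_def]; linarith
  set lam : ℝ := 1 - s * C with hlam_def
  have hlam0 : 0 < lam := by rw [hlam_def, hC_def]; linarith
  have hR0 : (0 : ℝ) < R₀ := by
    have h1 : 0 < κ + 4 * s * (1 + κ) := by positivity
    by_contra h0
    have : (R₀ : ℝ) ≤ 0 := not_lt.mp h0
    have hR0' : (R₀ : ℝ) = 0 := le_antisymm this (Nat.cast_nonneg R₀)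
    rw [hR0'] at hR
    linarith
  have hR1 : 1 ≤ R₀ := by exact_mod_cast (show (0 : ℝ) < R₀ from hR0)
  have hρ0r : (0 : ℝ) < ρ₀ := by exact_mod_cast (show 0 < ρ₀ by omega)
  -- the last-step constant κ₀ = (4sC + κ)∕(ρ₀ λ)
  set κ₀ : ℝ := (4 * s * C + κ) / ((ρ₀ : ℝ) * lam) with hκ₀_def
  have hκ₀0 : 0 ≤ κ₀ := by rw [hκ₀_def]; positivity
  have hyoung' : s₀ * (1 + κ₀) ≤ 1 := by
    have hden : (0 : ℝ) < (ρ₀ : ℝ) * lam := mul_pos hρ0r hlam0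
    have e1 : s₀ * (1 + κ₀) = s₀ * ((ρ₀ : ℝ) * lam + (4 * s * C + κ)) / ((ρ₀ : ℝ) * lam) := by
      rw [hκ₀_def]; field_simp
    rw [e1, div_le_one hden, hlam_def, hC_def]
    exact hyoung
  -- the windows of the younger levels fit under the youngest ages of the older ones
  have hhilo : ∀ j j', j < j' → j' < r → hi j ≤ lo j' := by
    intro j j' hjj' hj'r
    induction j', hjj' using Nat.le_induction with
    | base =>
      show hi j ≤ lo (j + 1)
      rcases Nat.eq_zero_or_pos j with rfl | hjp
      · show hi 0 ≤ lo 1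
        have h2 := hsep0 (by omega)
        have h3 : hi 0 ≤ ρ₀ * hi 0 := Nat.le_mul_of_pos_left _ (by omega)
        omega
      · have h2 := hsep j (by omega) hj'r
        have h3 : hi j ≤ R₀ * hi j := Nat.le_mul_of_pos_left _ (by omega)
        omega
    | succ j' hle ih =>
      have h1 := ih (by omega)
      have h2 := hsep j' (by omega) hj'r
      have h3 := hlohi j' (by omega) (by omega)
      have h4 : hi j' ≤ R₀ * hi j' := Nat.le_mul_of_pos_left _ (by omega)
      omega
  obtain ⟨B, hB⟩ : ∃ B : ℕ → ℝ, ∀ j, B j = e m - ∑ i ∈ Ico j r, O i m := ⟨_, fun _ => rfl⟩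
  obtain ⟨U, hU⟩ : ∃ U : ℕ → ℝ, ∀ j, U j = ∑ i ∈ Ico (j + 1) r, ν i m * (C * B (i + 1)) := ⟨_, fun _ => rfl⟩
  have hBr : B r = e m := by rw [hB, Ico_self, sum_empty, sub_zero]
  have hB0 : B 0 = ε m := by rw [hB, hrec m, range_eq_Ico]
  rcases Nat.eq_zero_or_pos r with hr0 | hrpos
  · rw [hr0] at hBr; rw [← hB0, hBr]; exact he0 m
  -- one level with the variation budget D
  have level : ∀ j (D : ℝ), j < r → 0 ≤ D → (∀ j', j < j' → j' ≤ r → 0 ≤ B j') →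
      (∀ j', j < j' → j' < r → ∀ q, m < q → q ≤ m + hi j' → ε q ≤ C * B (j' + 1)) →
      (hi j : ℝ) * U j ≤ D * B (j + 1) →
      (∀ q, m < q → q ≤ m + hi j → ε q ≤ (1 + D) * B (j + 1)) ∧ (1 - x j m * (1 + D)) * B (j + 1) ≤ B j := by
    intro j D hjr hD hBnn hT hUj
    rw [hU j] at hUj
    exact cluster_cascade_level_two hjr hC1 hD hw0 hwa hν0 hrow hO (fun j' hjj' hj'r => hhilo j j' hjj' hj'r)
      (fun j' d T hjj' hj'r => hvar j' m d T (by omega) hj'r) hea hrec IH hB hBnn hT hUj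
  -- THE DESCENT from j = r to j = 1; the U-bound handed down uses κ between older levels and κ₀ for the last gap
  have main : ∀ n j, j + n = r → 1 ≤ j →
      (∀ j', j ≤ j' → j' ≤ r → 0 ≤ B j') ∧
      (∀ j', j ≤ j' → j' < r → ∀ q, m < q → q ≤ m + hi j' → ε q ≤ C * B (j' + 1)) ∧
      ((hi (j - 1) : ℝ) * U (j - 1) ≤ (if j = 1 then κ₀ else κ) * B j) := by
    intro n
    induction n with
    | zero =>
      intro j hj hj1
      rw [add_zero] at hj
      subst hj
      refine ⟨fun j' h1 h2 => ?_, fun j' h1 h2 => absurd h2 (not_lt.mpr h1), ?_⟩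
      · rw [show j' = j from le_antisymm h2 h1, hBr]; exact he0 m
      · rw [hU, show j - 1 + 1 = j from Nat.sub_add_cancel hj1, Ico_self, sum_empty, mul_zero, hBr]
        split_ifs
        · exact mul_nonneg hκ₀0 (he0 m)
        · exact mul_nonneg hκ.le (he0 m)
    | succ n ih =>
      intro j hj hj1
      obtain ⟨hBnn, hT, hUj⟩ := ih (j + 1) (by omega) (by omega)
      have hjr : j < r := by omega
      rw [Nat.add_sub_cancel, if_neg (by omega : j + 1 ≠ 1)] at hUj
      obtain ⟨htar, hpeel⟩ := level j κ hjr hκ.le (fun j' h1 h2 => hBnn j' (by omega) h2) (fun j' h1 h2 => hT j' (by omega) h2) hUj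
      rw [← hC_def] at htar hpeel
      have hBj1 : 0 ≤ B (j + 1) := hBnn (j + 1) le_rfl (by omega)
      have hxs : x j m ≤ s := hcap j m hj1 hjr
      have hxj0 : 0 ≤ x j m := hx0 j m
      have hBj : lam * B (j + 1) ≤ B j := by
        have h1 : lam ≤ 1 - x j m * C := by
          rw [hlam_def]; nlinarith [mul_le_mul_of_nonneg_right hxs (show (0:ℝ) ≤ C by linarith)]
        exact (mul_le_mul_of_nonneg_right h1 hBj1).trans hpeel
      have hBj0 : 0 ≤ B j := le_trans (mul_nonneg hlam0.le hBj1) hBj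
      refine ⟨fun j' h1 h2 => ?_, fun j' h1 h2 => ?_, ?_⟩
      · by_cases hj' : j' = j
        · rw [hj']; exact hBj0
        · exact hBnn j' (by omega) h2
      · by_cases hj' : j' = j
        · subst hj'; exact htar
        · exact hT j' (by omega) h2
      · -- the variation rate one level down
        have hUsplit : U (j - 1) = ν j m * (C * B (j + 1)) + U j := by
          rw [hU (j - 1), hU j, Nat.sub_add_cancel hj1, sum_eq_sum_Ico_succ_bot hjr]
        have hlh : (lo j : ℝ) ≤ hi j := by exact_mod_cast hlohi j hj1 hjr
        have hC0 : (0 : ℝ) ≤ C := by linarith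
        have hUj0 : 0 ≤ U j := by
          rw [hU j]
          exact sum_nonneg fun i hi' => mul_nonneg (hν0 i m)
            (mul_nonneg hC0 (hBnn (i + 1) (by have := (mem_Ico.mp hi').1; omega) (by have := (mem_Ico.mp hi').2; omega)))
        have hU0 : 0 ≤ U (j - 1) := by
          rw [hUsplit]; exact add_nonneg (mul_nonneg (hν0 j m) (mul_nonneg hC0 hBj1)) hUj0
        -- lo_j U_{j−1} ≤ (4 s C + κ) B(j+1) ≤ (4sC + κ)∕λ · B j
        have hcore : (lo j : ℝ) * U (j - 1) ≤ (κ + 4 * s * C) * B (j + 1) := by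
          have hνx' := hνx j m hj1 hjr
          have hCB : 0 ≤ C * B (j + 1) := mul_nonneg hC0 hBj1
          calc (lo j : ℝ) * U (j - 1) = ((lo j : ℝ) * ν j m) * (C * B (j + 1)) + (lo j : ℝ) * U j := by rw [hUsplit]; ring
            _ ≤ 4 * x j m * (C * B (j + 1)) + (hi j : ℝ) * U j :=
                add_le_add (mul_le_mul_of_nonneg_right hνx' hCB) (mul_le_mul_of_nonneg_right hlh hUj0)
            _ ≤ 4 * s * (C * B (j + 1)) + κ * B (j + 1) := by
                have := mul_le_mul_of_nonneg_right hxs hCB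
                linarith
            _ = (κ + 4 * s * C) * B (j + 1) := by ring
        have hcore' : (κ + 4 * s * C) * B (j + 1) ≤ (κ + 4 * s * C) / lam * B j := by
          have hk0 : 0 ≤ κ + 4 * s * C := by positivity
          rw [div_mul_eq_mul_div, le_div_iff₀ hlam0]
          calc (κ + 4 * s * C) * B (j + 1) * lam = (κ + 4 * s * C) * (lam * B (j + 1)) := by ring
            _ ≤ (κ + 4 * s * C) * B j := mul_le_mul_of_nonneg_left hBj hk0
        by_cases hj1' : j = 1
        · -- the last gap: ρ₀ hi_0 ≤ lo_1, conclude with κ₀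
          subst hj1'
          rw [if_pos rfl]
          have hl1 : (ρ₀ : ℝ) * hi 0 ≤ lo 1 := by exact_mod_cast hsep0 (by omega)
          have h1 : (ρ₀ : ℝ) * ((hi 0 : ℝ) * U 0) ≤ (κ + 4 * s * C) / lam * B 1 := by
            calc (ρ₀ : ℝ) * ((hi 0 : ℝ) * U 0) = ((ρ₀ : ℝ) * hi 0) * U 0 := by ring
              _ ≤ (lo 1 : ℝ) * U 0 := mul_le_mul_of_nonneg_right hl1 hU0
              _ ≤ (κ + 4 * s * C) * B 2 := hcore
              _ ≤ (κ + 4 * s * C) / lam * B 1 := hcore'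
          have e1 : (κ + 4 * s * C) / lam * B 1 = (ρ₀ : ℝ) * (κ₀ * B 1) := by
            rw [hκ₀_def]; field_simp; ring
          rw [e1] at h1
          simpa using le_of_mul_le_mul_left h1 hρ0r
        · -- an older gap: R₀ hi_{j−1} ≤ lo_j, conclude with κ
          rw [if_neg hj1']
          have hlj : (R₀ : ℝ) * hi (j - 1) ≤ lo j := by
            have := hsep (j - 1) (by omega) (by omega)
            rw [Nat.sub_add_cancel hj1] at this
            exact_mod_cast this
          have h1 : (R₀ : ℝ) * ((hi (j - 1) : ℝ) * U (j - 1)) ≤ (κ + 4 * s * C) * B (j + 1) := by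
            calc (R₀ : ℝ) * ((hi (j - 1) : ℝ) * U (j - 1)) = ((R₀ : ℝ) * hi (j - 1)) * U (j - 1) := by ring
              _ ≤ (lo j : ℝ) * U (j - 1) := mul_le_mul_of_nonneg_right hlj hU0
              _ ≤ (κ + 4 * s * C) * B (j + 1) := hcore
          have h2 : (κ + 4 * s * C) * B (j + 1) ≤ (R₀ : ℝ) * (κ * B j) := by
            have hR' : κ + 4 * s * C ≤ (R₀ : ℝ) * lam * κ := by rw [hC_def, hlam_def, hC_def]; exact hR
            calc (κ + 4 * s * C) * B (j + 1) ≤ (R₀ : ℝ) * lam * κ * B (j + 1) := mul_le_mul_of_nonneg_right hR' hBj1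
              _ = (R₀ : ℝ) * (κ * (lam * B (j + 1))) := by ring
              _ ≤ (R₀ : ℝ) * (κ * B j) := mul_le_mul_of_nonneg_left (mul_le_mul_of_nonneg_left hBj hκ.le) hR0.le
          exact le_of_mul_le_mul_left (h1.trans h2) hR0
  -- THE LAST LEVEL with the budget κ₀
  obtain ⟨hBnn, hT, hU0⟩ := main (r - 1) 1 (by omega) le_rfl
  rw [Nat.sub_self, if_pos rfl] at hU0
  obtain ⟨-, hpeel⟩ := level 0 κ₀ hrpos hκ₀0 (fun j' h1 h2 => hBnn j' (by omega) h2) (fun j' h1 h2 => hT j' (by omega) h2) hU0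
  have hB1 : 0 ≤ B 1 := hBnn 1 le_rfl (by omega)
  have hxs : x 0 m ≤ s₀ := hcap0 m
  have hx00 : 0 ≤ x 0 m := hx0 0 m
  have h1 : 0 ≤ 1 - x 0 m * (1 + κ₀) := by nlinarith [mul_le_mul_of_nonneg_right hxs (show (0:ℝ) ≤ 1 + κ₀ by linarith)]
  rw [← hB0]
  exact le_trans (mul_nonneg h1 hB1) hpeel

end Summit.QuantumFields.BalabanUV.Beta.EriceRemainderEnclosureHistoryAutonomyComparisonAgeCompositionClusterCascadeYoungest

end
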